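import Mathlib
import Literature.MathematicalPhysics.QuantumLattice.FermiRG.Salmhofer1998Sec5
import Literature.MathematicalPhysics.QuantumLattice.FermiRG.Salmhofer1998TorusIBP
import HarnessLib

/-!
# Salmhofer 1998, Lemma 5 — toolkit III: the volume of the shell `{|E(𝐤)| ≤ ε}` is `O(ε)`

M. Salmhofer, *Continuous renormalization for fermions and Fermi liquid theory*, Commun. Math. Phys.
**194** (1998) 249–295 = arXiv:cond-mat/9706188 [Salmhofer1998].  In the proofs of Lemma 4 ((5.19)–
(5.21)) and Lemma 5 ((5.26)) the only input about the dispersion relation beyond smoothness is the volume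
bound "`∫_𝓑 d𝐩 1(|E(𝐩)| ≤ ε_t) ≤ ∫_{-ε_t}^{ε_t} dρ ∫dθ |J(ρ,θ)| = 2J₁ε_t`" (render
`paper:arxiv-cond-mat_9706188` p.20 L26–34), obtained there "by a change of coordinates" to the
low-energy chart `π` of §2.3 with Jacobian `J`.

This theorem-only companion of the FROZEN statement file `Salmhofer1998Sec5.lean` (licence F-086
`DotCovarianceL1Bound`; no definition, no named fact, net debt `0`) PROVES a bound of the same shape,
`vol{𝐤 ∈ [-π/ε, π/ε)^d : |E(𝐤)| ≤ ε'} ≤ C_E · ε'` for all `0 < ε' ≤ 1` (`exists_sublevel_volume_le`),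
directly from the hypotheses `ModelData.Hyp` of §2.3 (`E ∈ C^{k₀}`, `k₀ ≥ 2`, `(2π/ε)ℤ^d`-periodic,
`|∇E| ≥ g₀ > 0` on the Fermi surface `S = {E = 0}`) WITHOUT constructing the chart: (i) by compactness of
the closed cell and continuity of `∇E`, there is a threshold `η > 0` below which `|E(𝐤)| < η` forces
`|∇E(𝐤)| > g₀/2` (`exists_gradient_threshold`); (ii) then some coordinate derivative satisfies
`|∂_jE(𝐤)| ≥ g₀/(2(d+1))` (`exists_coord_of_opNorm_lt`); (iii) on each line in the direction `j` the set
`{|E| ≤ ε', |∂_jE| ≥ c}` has length `≤ (N+1)·4ε'/c` — cut the period into `N+1` pieces so short that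
`∂_jE` keeps its sign and stays `≥ c/2` on every piece meeting the set (Lipschitz bound on `∂_jE` from
`E ∈ C²` periodic), where `E` is then monotone with speed `≥ c/2` (`volume_slice_le`); (iv) Fubini in
the coordinate `j` (`volume_sublevel_coord_le`); (v) above the threshold the trivial bound
`vol ≤ (2π/ε)^d ≤ (2π/ε)^d ε'/η`.  The constant `C_E` depends on the model only (not on `β`, `t`), as
`J₁` does in print.  The case `d = 0` is included (there `S = ∅` is forced by `|∇E| ≥ g₀ > 0`).

No `instance`, no `notation`, no sorry/axiom; nothing about the Hubbard model is asserted or denied.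
-/

noncomputable section

open Filter Function MeasureTheory Set
open scoped Topology ContDiff ENNReal

namespace Literature.MathematicalPhysics.QuantumLattice.FermiRG

namespace Salmhofer1998

/-! ### One-dimensional slices: monotone pieces -/

/-- On an interval where `h' ≥ C > 0`, two points where `|h| ≤ ε` are at distance `≤ 2ε/C`.
[cite: Salmhofer1998, Lemma 4 proof (p.20 L26–34)] -/
theorem abs_sub_le_of_deriv_ge {h h' : ℝ → ℝ} (hh : ∀ s, HasDerivAt h (h' s) s) {a b C ε : ℝ}
    (hC : 0 < C) (hge : ∀ u ∈ Set.Icc a b, C ≤ h' u) {s s' : ℝ} (hs : s ∈ Set.Icc a b)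
    (hs' : s' ∈ Set.Icc a b) (h1 : |h s| ≤ ε) (h2 : |h s'| ≤ ε) : |s - s'| ≤ 2 * ε / C := by
  have hcont : ContinuousOn h (Set.Icc a b) :=
    fun u _ => (hh u).continuousAt.continuousWithinAt
  have hdiff : DifferentiableOn ℝ h (interior (Set.Icc a b)) :=
    fun u _ => (hh u).differentiableAt.differentiableWithinAt
  have hge' : ∀ u ∈ interior (Set.Icc a b), C ≤ deriv h u := by
    intro u hu
    rw [(hh u).deriv]
    exact hge u (interior_subset hu)
  have key := (convex_Icc a b).mul_sub_le_image_sub_of_le_deriv hcont hdiff hge'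
  rw [le_div_iff₀ hC]
  rcases le_total s s' with hle | hle
  · have := key s hs s' hs' hle
    rw [abs_sub_comm, abs_of_nonneg (by linarith)]
    have hh1 := (abs_le.mp h1).1
    have hh2 := (abs_le.mp h2).2
    nlinarith
  · have := key s' hs' s hs hle
    rw [abs_of_nonneg (by linarith)]
    have hh1 := (abs_le.mp h1).2
    have hh2 := (abs_le.mp h2).1
    nlinarith

/-- On a piece of length `ℓ` with `L ℓ ≤ c/2` (`L` a Lipschitz constant of `h'`) containing a point with
`|h'| ≥ c`, two points where `|h| ≤ ε` are at distance `≤ 4ε/c`. [cite: Salmhofer1998, Lemma 4 proof (p.20 L26–34)] -/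
theorem abs_sub_le_of_piece {h h' : ℝ → ℝ} (hh : ∀ s, HasDerivAt h (h' s) s) {L : ℝ} (hL : 0 ≤ L)
    (hlip : ∀ s s' : ℝ, |h' s - h' s'| ≤ L * |s - s'|) {c ε a ℓ : ℝ} (hc : 0 < c)
    (hLℓ : L * ℓ ≤ c / 2) {s₀ : ℝ} (hs₀ : s₀ ∈ Set.Icc a (a + ℓ)) (hc₀ : c ≤ |h' s₀|) {s s' : ℝ}
    (hs : s ∈ Set.Icc a (a + ℓ)) (hs' : s' ∈ Set.Icc a (a + ℓ)) (h1 : |h s| ≤ ε) (h2 : |h s'| ≤ ε) :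
    |s - s'| ≤ 4 * ε / c := by
  -- on the piece, `|h' u - h' s₀| ≤ L ℓ ≤ c/2`
  have hnear : ∀ u ∈ Set.Icc a (a + ℓ), |h' u - h' s₀| ≤ c / 2 := by
    intro u hu
    refine (hlip u s₀).trans ?_
    have hus : |u - s₀| ≤ ℓ := by
      rw [abs_le]; constructor <;> linarith [hu.1, hu.2, hs₀.1, hs₀.2]
    calc L * |u - s₀| ≤ L * ℓ := by gcongr
      _ ≤ c / 2 := hLℓ
  have h4 : 4 * ε / c = 2 * ε / (c / 2) := by field_simp; ring
  rw [h4]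
  rcases le_or_gt 0 (h' s₀) with hpos | hneg
  · -- `h' s₀ ≥ c`, so `h' ≥ c/2` on the piece
    have hc₀' : c ≤ h' s₀ := by rwa [abs_of_nonneg hpos] at hc₀
    refine abs_sub_le_of_deriv_ge hh (by linarith) ?_ hs hs' h1 h2
    intro u hu
    have := abs_le.mp (hnear u hu)
    linarith [this.1]
  · -- `h' s₀ ≤ -c`: work with `-h`
    have hc₀' : c ≤ -h' s₀ := by rwa [abs_of_neg hneg] at hc₀
    have hh' : ∀ s, HasDerivAt (fun s => -h s) (-h' s) s := fun s => (hh s).neg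
    refine abs_sub_le_of_deriv_ge hh' (by linarith) ?_ hs hs' (by simpa using h1) (by simpa using h2)
    intro u hu
    have := abs_le.mp (hnear u hu)
    linarith [this.2]

/-- **Slices**: for `h : ℝ → ℝ` with a Lipschitz derivative `h'` (constant `L`), the set
`{s ∈ [α, α+Λ] : |h(s)| ≤ ε, |h'(s)| ≥ c}` has Lebesgue measure `≤ (⌊Λ/ℓ⌋ + 1)·4ε/c`, where
`ℓ = c/(2(L+1))` — cover `[α, α+Λ]` by `⌊Λ/ℓ⌋ + 1` pieces of length `ℓ`; on each piece meeting the set,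
`h` is monotone with `|h'| ≥ c/2` (this is the one-dimensional content of the Jacobian bound
`∫ 1(|E| ≤ ε) ≤ 2J₁ε`). [cite: Salmhofer1998, Lemma 4 proof (p.20 L26–34)] -/
theorem volume_slice_le {h h' : ℝ → ℝ} (hh : ∀ s, HasDerivAt h (h' s) s) {L : ℝ} (hL : 0 ≤ L)
    (hlip : ∀ s s' : ℝ, |h' s - h' s'| ≤ L * |s - s'|) {c : ℝ} (hc : 0 < c) (ε α Λ : ℝ) :
    volume {s : ℝ | s ∈ Set.Icc α (α + Λ) ∧ |h s| ≤ ε ∧ c ≤ |h' s|} ≤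
      ENNReal.ofReal (((⌊Λ / (c / (2 * (L + 1)))⌋₊ : ℝ) + 1) * (4 * ε / c)) := by
  set ℓ : ℝ := c / (2 * (L + 1)) with hℓ
  have hℓpos : 0 < ℓ := by rw [hℓ]; positivity
  have hLℓ : L * ℓ ≤ c / 2 := by
    rw [hℓ, div_eq_mul_inv]
    have h1 : L * (c * (2 * (L + 1))⁻¹) = (c / 2) * (L / (L + 1)) := by
      field_simp
    rw [h1]
    have h2 : L / (L + 1) ≤ 1 := by
      rw [div_le_one (by linarith)]; linarith
    calc c / 2 * (L / (L + 1)) ≤ c / 2 * 1 := by gcongr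
      _ = c / 2 := mul_one _
  set N : ℕ := ⌊Λ / ℓ⌋₊ with hN
  set T : Set ℝ := {s : ℝ | s ∈ Set.Icc α (α + Λ) ∧ |h s| ≤ ε ∧ c ≤ |h' s|} with hT
  set piece : ℕ → Set ℝ := fun i => Set.Icc (α + i * ℓ) (α + i * ℓ + ℓ) with hpiece
  -- cover
  have hcover : T ⊆ ⋃ i ∈ Finset.range (N + 1), T ∩ piece i := by
    intro s hs
    have hsI := hs.1
    set i : ℕ := ⌊(s - α) / ℓ⌋₊ with hi
    have hsα : 0 ≤ (s - α) / ℓ := div_nonneg (by linarith [hsI.1]) hℓpos.le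
    have hi1 : (i : ℝ) ≤ (s - α) / ℓ := Nat.floor_le hsα
    have hi2 : (s - α) / ℓ < i + 1 := Nat.lt_floor_add_one _
    have hiN : i ≤ N := by
      apply Nat.floor_mono
      exact div_le_div_of_nonneg_right (by linarith [hsI.2]) hℓpos.le
    simp only [Set.mem_iUnion, Finset.mem_range, exists_prop]
    refine ⟨i, Nat.lt_succ_of_le hiN, hs, ?_⟩
    simp only [hpiece, Set.mem_Icc]
    rw [le_div_iff₀ hℓpos] at hi1
    rw [div_lt_iff₀ hℓpos] at hi2
    constructor <;> nlinarith
  -- each piece contributes at most `4ε/c`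
  have hpieceBound : ∀ i : ℕ, volume (T ∩ piece i) ≤ ENNReal.ofReal (4 * ε / c) := by
    intro i
    refine (Real.volume_le_diam _).trans (Metric.ediam_le ?_)
    intro s hs s' hs'
    obtain ⟨⟨_, hs1, hs2⟩, hsp⟩ := hs
    obtain ⟨⟨_, hs1', _⟩, hsp'⟩ := hs'
    rw [edist_dist, Real.dist_eq]
    apply ENNReal.ofReal_le_ofReal
    exact abs_sub_le_of_piece hh hL hlip hc hLℓ hsp hs2 hsp hsp' hs1 hs1'
  calc volume T ≤ volume (⋃ i ∈ Finset.range (N + 1), T ∩ piece i) := measure_mono hcover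
    _ ≤ ∑ i ∈ Finset.range (N + 1), volume (T ∩ piece i) := measure_biUnion_finset_le _ _
    _ ≤ ∑ _i ∈ Finset.range (N + 1), ENNReal.ofReal (4 * ε / c) :=
        Finset.sum_le_sum fun i _ => hpieceBound i
    _ = ENNReal.ofReal (((N : ℝ) + 1) * (4 * ε / c)) := by
        rw [Finset.sum_const, Finset.card_range, nsmul_eq_mul,
          ENNReal.ofReal_mul (by positivity)]
        congr 1
        rw [show ((N : ℝ) + 1) = ((N + 1 : ℕ) : ℝ) by push_cast; ring, ENNReal.ofReal_natCast]

/-! ### The gradient threshold and the choice of a coordinate -/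

section Threshold

variable {d : ℕ}

/-- The operator norm of a functional on `(ℝ^d, ‖·‖_∞)` is at most the `ℓ¹` norm of its values on the
coordinate vectors. [cite: Salmhofer1998, §2.3 (p.6 L152–157)] -/
theorem opNorm_le_sum_apply_single (Lf : (Fin d → ℝ) →L[ℝ] ℝ) :
    ‖Lf‖ ≤ ∑ j : Fin d, ‖Lf (Pi.single j (1 : ℝ))‖ := by
  refine ContinuousLinearMap.opNorm_le_bound _ (Finset.sum_nonneg fun _ _ => norm_nonneg _) ?_
  intro u
  have hu : u = ∑ j : Fin d, u j • (Pi.single j (1 : ℝ) : Fin d → ℝ) := by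
    ext i
    simp [Finset.sum_apply, Pi.single_apply]
  calc ‖Lf u‖ = ‖∑ j : Fin d, u j • Lf (Pi.single j (1 : ℝ))‖ := by
        conv_lhs => rw [hu]
        rw [map_sum]
        simp only [map_smul]
    _ ≤ ∑ j : Fin d, ‖u j • Lf (Pi.single j (1 : ℝ))‖ := norm_sum_le _ _
    _ = ∑ j : Fin d, |u j| * ‖Lf (Pi.single j (1 : ℝ))‖ := by
        congr 1; funext j; rw [norm_smul, Real.norm_eq_abs]
    _ ≤ ∑ j : Fin d, ‖u‖ * ‖Lf (Pi.single j (1 : ℝ))‖ := by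
        gcongr with j
        exact (Real.norm_eq_abs _).symm.le.trans (norm_le_pi_norm u j)
    _ = (∑ j : Fin d, ‖Lf (Pi.single j (1 : ℝ))‖) * ‖u‖ := by
        rw [Finset.sum_mul]
        exact Finset.sum_congr rfl fun j _ => mul_comm _ _

/-- If `‖L‖ > g > 0` then some coordinate value satisfies `|L(e_j)| ≥ g/(d+1)`.
[cite: Salmhofer1998, §2.3 (p.6 L152–157)] -/
theorem exists_coord_of_lt_opNorm (Lf : (Fin d → ℝ) →L[ℝ] ℝ) {g : ℝ} (hg : 0 < g) (h : g < ‖Lf‖) :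
    ∃ j : Fin d, g / (d + 1) ≤ |Lf (Pi.single j (1 : ℝ))| := by
  by_contra hcon
  push Not at hcon
  have hsum : ∑ j : Fin d, ‖Lf (Pi.single j (1 : ℝ))‖ ≤ d * (g / (d + 1)) := by
    calc ∑ j : Fin d, ‖Lf (Pi.single j (1 : ℝ))‖ ≤ ∑ _j : Fin d, g / (d + 1) :=
          Finset.sum_le_sum fun j _ => by rw [Real.norm_eq_abs]; exact (hcon j).le
      _ = d * (g / (d + 1)) := by simp
  have h1 := opNorm_le_sum_apply_single Lf
  have h2 : (d : ℝ) * (g / (d + 1)) < g := by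
    rw [← mul_div_assoc, div_lt_iff₀ (by positivity)]
    nlinarith
  linarith

/-- **The gradient threshold**: under the §2.3 hypotheses there is `η > 0` such that on the closed cell
`[-b,b]^d`, `|E(𝐤)| < η` implies `‖∇E(𝐤)‖ > g₀/2` (compactness + continuity of `∇E` + `|∇E| ≥ g₀` on
`S = {E = 0}`). [cite: Salmhofer1998, §2.3 (p.6 L152–157)] -/
theorem exists_gradient_threshold {M : ModelData d} (hM : M.Hyp) (b : ℝ) :
    ∃ η g : ℝ, 0 < η ∧ 0 < g ∧ ∀ p ∈ Set.pi Set.univ (fun _ : Fin d => Set.Icc (-b) b),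
      |M.E p| < η → g < ‖fderiv ℝ M.E p‖ := by
  obtain ⟨g₀, hg₀, hgrad⟩ := hM.grad_lower
  have hEc : Continuous M.E := hM.contDiff_E.continuous
  have h2 : (2 : ℕ∞ω) ≤ (M.k0 : ℕ∞ω) := by exact_mod_cast hM.two_le_k0
  have hfc : Continuous (fderiv ℝ M.E) :=
    hM.contDiff_E.continuous_fderiv (by
      intro h0
      have : (M.k0 : ℕ∞ω) = 0 := h0
      have h2' := h2
      rw [this] at h2'
      exact absurd h2' (by norm_num))
  set K : Set (Fin d → ℝ) := Set.pi Set.univ (fun _ : Fin d => Set.Icc (-b) b) with hK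
  have hKc : IsCompact K := isCompact_univ_pi fun _ => isCompact_Icc
  set K₀ : Set (Fin d → ℝ) := K ∩ {p | ‖fderiv ℝ M.E p‖ ≤ g₀ / 2} with hK₀
  have hK₀c : IsCompact K₀ :=
    hKc.inter_right (isClosed_le (continuous_norm.comp hfc) continuous_const)
  by_cases hne : K₀.Nonempty
  · obtain ⟨p₀, hp₀, hmin⟩ :=
      hK₀c.exists_isMinOn hne (continuous_abs.comp hEc).continuousOn
    have hpos : 0 < |M.E p₀| := by
      rw [abs_pos]
      intro h0
      have hS : p₀ ∈ M.fermiSurface := h0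
      have := hgrad p₀ hS
      have := hp₀.2
      simp only [Set.mem_setOf_eq] at this
      linarith
    refine ⟨|M.E p₀|, g₀ / 2, hpos, by linarith, ?_⟩
    intro p hp hlt
    by_contra hle
    push Not at hle
    have hpK₀ : p ∈ K₀ := ⟨hp, hle⟩
    have := hmin hpK₀
    simp only [Set.mem_setOf_eq, Function.comp_apply] at this
    linarith
  · refine ⟨1, g₀ / 2, one_pos, by linarith, ?_⟩
    intro p hp _
    by_contra hle
    push Not at hle
    exact hne ⟨p, hp, hle⟩

end Threshold

/-! ### Fubini in one coordinate -/

section Coord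

variable {n : ℕ}

/-- **The coordinate estimate**: for `E ∈ C²(ℝ^{n+1})` with `|∂_j²E| ≤ L`, the set
`{𝐤 ∈ [-b,b]^{n+1} : |E(𝐤)| ≤ ε, |∂_jE(𝐤)| ≥ c}` has volume `≤ (⌊2b/ℓ⌋+1)(4ε/c)(2b)^n`,
`ℓ = c/(2(L+1))` (Fubini in the coordinate `j` and `volume_slice_le` on every line).
[cite: Salmhofer1998, Lemma 4 proof (p.20 L26–34)] -/
theorem volume_sublevel_coord_le (j : Fin (n + 1)) {E : (Fin (n + 1) → ℝ) → ℝ} (hE : ContDiff ℝ 2 E)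
    {L : ℝ} (hL : 0 ≤ L) (hD2 : ∀ k, ‖dirDeriv (Pi.single j (1 : ℝ)) 2 E k‖ ≤ L)
    {b c ε : ℝ} (hb : 0 < b) (hc : 0 < c) (hε : 0 < ε) :
    volume {p : Fin (n + 1) → ℝ | p ∈ Set.pi Set.univ (fun _ : Fin (n + 1) => Set.Icc (-b) b) ∧
        |E p| ≤ ε ∧ c ≤ |fderiv ℝ E p (Pi.single j (1 : ℝ))|} ≤
      ENNReal.ofReal ((((⌊(2 * b) / (c / (2 * (L + 1)))⌋₊ : ℝ) + 1) * (4 * ε / c)) * (2 * b) ^ n) := by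
  set v : Fin (n + 1) → ℝ := Pi.single j (1 : ℝ) with hv
  set K : Set (Fin (n + 1) → ℝ) := Set.pi Set.univ (fun _ : Fin (n + 1) => Set.Icc (-b) b) with hK
  set A : Set (Fin (n + 1) → ℝ) := {p | p ∈ K ∧ |E p| ≤ ε ∧ c ≤ |fderiv ℝ E p v|} with hA
  have hEc : Continuous E := hE.continuous
  have hfc : Continuous fun p => fderiv ℝ E p v :=
    (hE.continuous_fderiv (by norm_num)).clm_apply continuous_const
  have hAm : MeasurableSet A := by
    have hKcl : IsClosed K := isClosed_set_pi fun _ _ => isClosed_Icc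
    have h1 : IsClosed {p : Fin (n + 1) → ℝ | |E p| ≤ ε} :=
      isClosed_le (continuous_abs.comp hEc) continuous_const
    have h2 : IsClosed {p : Fin (n + 1) → ℝ | c ≤ |fderiv ℝ E p v|} :=
      isClosed_le continuous_const (continuous_abs.comp hfc)
    have : A = K ∩ ({p | |E p| ≤ ε} ∩ {p | c ≤ |fderiv ℝ E p v|}) := by
      ext p
      simp only [hA, Set.mem_inter_iff, Set.mem_setOf_eq]
    rw [this]
    exact (hKcl.inter (h1.inter h2)).measurableSet
  -- separate the coordinate `j`
  set e := MeasurableEquiv.piFinSuccAbove (fun _ : Fin (n + 1) => ℝ) j with he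
  have hmp : MeasurePreserving e volume ((volume : Measure ℝ).prod volume) :=
    volume_preserving_piFinSuccAbove (fun _ : Fin (n + 1) => ℝ) j
  have hvolA : volume A = ((volume : Measure ℝ).prod volume) (e.symm ⁻¹' A) :=
    (hmp.symm.measure_preimage hAm.nullMeasurableSet).symm
  rw [hvolA, Measure.prod_apply_symm (e.symm.measurable hAm)]
  -- the slices
  set boxn : Set (Fin n → ℝ) := Set.pi Set.univ (fun _ : Fin n => Set.Icc (-b) b) with hboxn
  set B : ℝ≥0∞ :=
    ENNReal.ofReal (((⌊(2 * b) / (c / (2 * (L + 1)))⌋₊ : ℝ) + 1) * (4 * ε / c)) with hB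
  have hslice : ∀ k' : Fin n → ℝ,
      volume ((fun s : ℝ => (s, k')) ⁻¹' (e.symm ⁻¹' A)) ≤ boxn.indicator (fun _ => B) k' := by
    intro k'
    set k₀ : Fin (n + 1) → ℝ := Fin.insertNth j (0 : ℝ) k' with hk₀
    have hsymm : ∀ s : ℝ, (e.symm (s, k') : Fin (n + 1) → ℝ) = k₀ + s • v := by
      intro s
      have : (e.symm (s, k') : Fin (n + 1) → ℝ) = Fin.insertNth j s k' := rfl
      rw [this, insertNth_eq_add_smul]
    by_cases hk' : k' ∈ boxn
    · rw [Set.indicator_of_mem hk']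
      -- the slice lies in the one-dimensional set of `volume_slice_le`
      set h : ℝ → ℝ := fun s => E (k₀ + s • v) with hh
      set h' : ℝ → ℝ := fun s => dirDeriv v 1 E (k₀ + s • v) with hh'
      have hEd : Differentiable ℝ E := hE.differentiable (by norm_num)
      have hhd : ∀ s, HasDerivAt h (h' s) s := fun s => hasDerivAt_line v hEd k₀ s
      have hd1 : ContDiff ℝ 1 (dirDeriv v 1 E) :=
        contDiff_dirDeriv v (m := 1) (i := 1) (by exact_mod_cast hE)
      have hh'd : ∀ s, HasDerivAt h' (dirDeriv v 2 E (k₀ + s • v)) s := by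
        intro s
        have := hasDerivAt_line v (hd1.differentiable (by norm_num)) k₀ s
        rw [dirDeriv_succ']
        exact this
      have hlip : ∀ s s' : ℝ, |h' s - h' s'| ≤ L * |s - s'| := by
        intro s s'
        have := Convex.norm_image_sub_le_of_norm_deriv_le (f := h') (s := Set.univ)
          (fun u _ => (hh'd u).differentiableAt)
          (fun u _ => by rw [(hh'd u).deriv]; exact hD2 _) convex_univ (Set.mem_univ s')
          (Set.mem_univ s)
        simpa [Real.norm_eq_abs] using this
      have hsub : ((fun s : ℝ => (s, k')) ⁻¹' (e.symm ⁻¹' A)) ⊆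
          {s : ℝ | s ∈ Set.Icc (-b) (-b + 2 * b) ∧ |h s| ≤ ε ∧ c ≤ |h' s|} := by
        intro s hs
        simp only [Set.mem_preimage] at hs
        rw [hsymm s] at hs
        obtain ⟨hsK, hsE, hsD⟩ := hs
        refine ⟨?_, hsE, ?_⟩
        · have := hsK j (Set.mem_univ j)
          simp only [Pi.add_apply, Pi.smul_apply, hk₀, hv, Fin.insertNth_apply_same,
            Pi.single_eq_same, smul_eq_mul, mul_one, zero_add, Set.mem_Icc] at this
          simp only [Set.mem_Icc]
          constructor <;> linarith [this.1, this.2]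
        · simpa [hh', dirDeriv_one] using hsD
      calc volume ((fun s : ℝ => (s, k')) ⁻¹' (e.symm ⁻¹' A))
          ≤ volume {s : ℝ | s ∈ Set.Icc (-b) (-b + 2 * b) ∧ |h s| ≤ ε ∧ c ≤ |h' s|} :=
            measure_mono hsub
        _ ≤ B := by
            rw [hB]
            exact volume_slice_le hhd hL hlip hc ε (-b) (2 * b)
    · rw [Set.indicator_of_notMem hk']
      -- the slice is empty
      have hempty : ((fun s : ℝ => (s, k')) ⁻¹' (e.symm ⁻¹' A)) = ∅ := by
        ext s
        simp only [Set.mem_preimage, Set.mem_empty_iff_false, iff_false]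
        intro hs
        apply hk'
        have hsK := hs.1
        intro i _
        have := hsK (j.succAbove i) (Set.mem_univ _)
        have hval : (e.symm (s, k') : Fin (n + 1) → ℝ) (j.succAbove i) = k' i := by
          have : (e.symm (s, k') : Fin (n + 1) → ℝ) = Fin.insertNth j s k' := rfl
          rw [this, Fin.insertNth_apply_succAbove]
        rw [hval] at this
        exact this
      rw [hempty, measure_empty]
  -- integrate the slice bound
  have hboxm : MeasurableSet boxn := MeasurableSet.univ_pi fun _ => measurableSet_Icc
  calc ∫⁻ k', volume ((fun s : ℝ => (s, k')) ⁻¹' (e.symm ⁻¹' A))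
      ≤ ∫⁻ k', boxn.indicator (fun _ => B) k' := lintegral_mono hslice
    _ = B * volume boxn := lintegral_indicator_const hboxm B
    _ = B * ENNReal.ofReal ((2 * b) ^ n) := by
        congr 1
        rw [hboxn, volume_pi_pi]
        simp only [Real.volume_Icc, Finset.prod_const, Finset.card_univ, Fintype.card_fin]
        rw [show b - -b = 2 * b by ring, ENNReal.ofReal_pow (by linarith)]
    _ = ENNReal.ofReal ((((⌊(2 * b) / (c / (2 * (L + 1)))⌋₊ : ℝ) + 1) * (4 * ε / c)) *
          (2 * b) ^ n) := by
        rw [hB, ← ENNReal.ofReal_mul (by positivity)]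

end Coord

/-! ### The volume of the shell `{|E| ≤ ε}` in the Brillouin zone -/

section Sublevel

variable {d : ℕ}

/-- The Brillouin-zone box lies in the closed cell `[-π/ε, π/ε]^d`. [cite: Salmhofer1998, §2.3 (p.6 L142–144)] -/
theorem bzBox_subset_pi_Icc (d : ℕ) (latt : ℝ) :
    bzBox d latt ⊆ Set.pi Set.univ (fun _ : Fin d => Set.Icc (-(Real.pi / latt)) (Real.pi / latt)) :=
  Set.pi_mono fun _ _ => Set.Ico_subset_Icc_self

/-- The volume of the closed cell `[-b,b]^d` is `(2b)^d`. [cite: Salmhofer1998, §2.3 (p.6 L142–144)] -/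
theorem volume_pi_Icc_eq (d : ℕ) {b : ℝ} (hb : 0 ≤ b) :
    volume (Set.pi Set.univ (fun _ : Fin d => Set.Icc (-b) b)) = ENNReal.ofReal ((2 * b) ^ d) := by
  rw [volume_pi_pi]
  simp only [Real.volume_Icc, Finset.prod_const, Finset.card_univ, Fintype.card_fin]
  rw [show b - -b = 2 * b by ring, ENNReal.ofReal_pow (by linarith)]

/-- **The shell volume is `O(ε)`** (the content of "`∫_𝓑 d𝐩 1(|E(𝐩)| ≤ ε) ≤ 2J₁ε`" for the §2.3 class,
proved without the chart `π`): there is `C_E ≥ 0`, depending only on the model, with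
`vol{𝐤 ∈ [-π/ε, π/ε)^d : |E(𝐤)| ≤ ε'} ≤ C_E ε'` for all `0 < ε' ≤ 1`.
[cite: Salmhofer1998, Lemma 4 proof (5.19)–(5.21) (p.20 L26–34); Lemma 5 proof (5.26) (p.20 L106–108)] -/
theorem exists_sublevel_volume_le {M : ModelData d} (hM : M.Hyp) :
    ∃ C : ℝ, 0 ≤ C ∧ ∀ ε : ℝ, 0 < ε → ε ≤ 1 →
      volume (bzBox d M.latt ∩ {p | |M.E p| ≤ ε}) ≤ ENNReal.ofReal (C * ε) := by
  set b : ℝ := Real.pi / M.latt with hb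
  have hbpos : 0 < b := div_pos Real.pi_pos hM.latt_pos
  set K : Set (Fin d → ℝ) := Set.pi Set.univ (fun _ : Fin d => Set.Icc (-b) b) with hK
  have hsubK : bzBox d M.latt ⊆ K := bzBox_subset_pi_Icc d M.latt
  have hvolK : volume K = ENNReal.ofReal ((2 * b) ^ d) := volume_pi_Icc_eq d hbpos.le
  obtain ⟨η, g, hη, hg, hthr⟩ := exists_gradient_threshold hM b
  -- the trivial bound above the threshold
  have htriv : ∀ ε : ℝ, η ≤ ε →
      volume (bzBox d M.latt ∩ {p | |M.E p| ≤ ε}) ≤ ENNReal.ofReal ((2 * b) ^ d / η * ε) := by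
    intro ε hε
    calc volume (bzBox d M.latt ∩ {p | |M.E p| ≤ ε}) ≤ volume K :=
          measure_mono (Set.inter_subset_left.trans hsubK)
      _ = ENNReal.ofReal ((2 * b) ^ d) := hvolK
      _ ≤ ENNReal.ofReal ((2 * b) ^ d / η * ε) := by
          apply ENNReal.ofReal_le_ofReal
          rw [div_mul_eq_mul_div, le_div_iff₀ hη]
          exact mul_le_mul_of_nonneg_left hε (pow_nonneg (by linarith) _)
  -- below the threshold every point of the shell has a large coordinate derivative
  have hcoord : ∀ ε : ℝ, ε < η → ∀ p ∈ bzBox d M.latt ∩ {p | |M.E p| ≤ ε},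
      ∃ j : Fin d, g / (d + 1) ≤ |fderiv ℝ M.E p (Pi.single j (1 : ℝ))| := by
    intro ε hε p hp
    exact exists_coord_of_lt_opNorm _ hg (hthr p (hsubK hp.1) (lt_of_le_of_lt hp.2 hε))
  cases d with
  | zero =>
    refine ⟨(2 * b) ^ 0 / η, by positivity, fun ε hε _ => ?_⟩
    rcases lt_or_ge ε η with hlt | hge
    · -- the shell is empty: no coordinate exists in dimension `0`
      have hempty : bzBox 0 M.latt ∩ {p | |M.E p| ≤ ε} = ∅ := by
        ext p
        simp only [Set.mem_empty_iff_false, iff_false]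
        intro hp
        obtain ⟨j, _⟩ := hcoord ε hlt p hp
        exact Fin.elim0 j
      rw [hempty, measure_empty]
      exact bot_le
    · exact htriv ε hge
  | succ n =>
    -- second derivatives of `E` along coordinate lines are bounded (periodicity)
    have hE2 : ContDiff ℝ 2 M.E := hM.contDiff_E.of_le (by exact_mod_cast hM.two_le_k0)
    have hP : 0 < 2 * Real.pi / M.latt := div_pos (by positivity) hM.latt_pos
    obtain ⟨D, hD1, hD⟩ := exists_bound_dirDeriv_periodic (N := 2) hE2 hP
      (fun k z => hM.periodic_E k z)
    set L : ℝ := D ^ 2 with hL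
    have hL0 : 0 ≤ L := by positivity
    have hD2 : ∀ (j : Fin (n + 1)) (k : Fin (n + 1) → ℝ),
        ‖dirDeriv (Pi.single j (1 : ℝ)) 2 M.E k‖ ≤ L := fun j k => hD j 2 (by norm_num) le_rfl k
    set c : ℝ := g / ((n + 1 : ℕ) + 1) with hc
    have hcpos : 0 < c := by rw [hc]; positivity
    set C₁ : ℝ := (((⌊(2 * b) / (c / (2 * (L + 1)))⌋₊ : ℝ) + 1) * (4 / c)) * (2 * b) ^ n with hC₁
    have hC₁0 : 0 ≤ C₁ := by rw [hC₁]; positivity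
    refine ⟨(n + 1) * C₁ + (2 * b) ^ (n + 1) / η, by positivity, fun ε hε _ => ?_⟩
    rcases lt_or_ge ε η with hlt | hge
    · -- cover by the coordinate sets and add up
      have hcover : bzBox (n + 1) M.latt ∩ {p | |M.E p| ≤ ε} ⊆
          ⋃ j : Fin (n + 1), {p : Fin (n + 1) → ℝ | p ∈ K ∧ |M.E p| ≤ ε ∧
            c ≤ |fderiv ℝ M.E p (Pi.single j (1 : ℝ))|} := by
        intro p hp
        obtain ⟨j, hj⟩ := hcoord ε hlt p hp
        simp only [Set.mem_iUnion, Set.mem_setOf_eq]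
        exact ⟨j, hsubK hp.1, hp.2, hj⟩
      have hAj : ∀ j : Fin (n + 1), volume {p : Fin (n + 1) → ℝ | p ∈ K ∧ |M.E p| ≤ ε ∧
          c ≤ |fderiv ℝ M.E p (Pi.single j (1 : ℝ))|} ≤ ENNReal.ofReal (C₁ * ε) := by
        intro j
        refine (volume_sublevel_coord_le j hE2 hL0 (hD2 j) hbpos hcpos hε).trans (le_of_eq ?_)
        congr 1
        rw [hC₁]; ring
      calc volume (bzBox (n + 1) M.latt ∩ {p | |M.E p| ≤ ε})
          ≤ volume (⋃ j : Fin (n + 1), {p : Fin (n + 1) → ℝ | p ∈ K ∧ |M.E p| ≤ ε ∧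
              c ≤ |fderiv ℝ M.E p (Pi.single j (1 : ℝ))|}) := measure_mono hcover
        _ ≤ ∑ j : Fin (n + 1), volume {p : Fin (n + 1) → ℝ | p ∈ K ∧ |M.E p| ≤ ε ∧
              c ≤ |fderiv ℝ M.E p (Pi.single j (1 : ℝ))|} := measure_iUnion_fintype_le _ _
        _ ≤ ∑ _j : Fin (n + 1), ENNReal.ofReal (C₁ * ε) := Finset.sum_le_sum fun j _ => hAj j
        _ = ENNReal.ofReal (((n + 1 : ℕ) : ℝ) * (C₁ * ε)) := by
            rw [Finset.sum_const, Finset.card_univ, Fintype.card_fin, nsmul_eq_mul,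
              ← ENNReal.ofReal_natCast, ← ENNReal.ofReal_mul (by positivity)]
        _ ≤ ENNReal.ofReal (((n + 1) * C₁ + (2 * b) ^ (n + 1) / η) * ε) := by
            apply ENNReal.ofReal_le_ofReal
            have : 0 ≤ (2 * b) ^ (n + 1) / η * ε := by positivity
            push_cast
            nlinarith
    · refine (htriv ε hge).trans ?_
      apply ENNReal.ofReal_le_ofReal
      have : 0 ≤ ((n : ℝ) + 1) * C₁ * ε := by positivity
      nlinarith

end Sublevel

end Salmhofer1998

end Literature.MathematicalPhysics.QuantumLattice.FermiRG
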